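import Mathlib
import HarnessLib
import Summits.HubbardSuperconductivity.HubbardSuperconductivity.Theorems.KLProgrammeKLRegimeEngineTowerDoorToKit
import Summits.HubbardSuperconductivity.HubbardSuperconductivity.Theorems.KLProgrammeKLRegimeEngineTowerDoorToKitFO

/-!
# Route `KLProgramme` — crux K3 ENGINE (stmt-HubbardSuperconductivity-20437 `KLRegimeEngineV17F2`), stub (b) v2, THE LEVELS PACKAGE (ℓ):
# (I1-dim), the PRESCRIBED bricks — the prescribed (Hstep) doors' right sides are dominated by the kit's step right side
# (E1-LEVELS-BLUEPRINT-g8 §9; twin of E1's `…TowerDoorToKit` / `…TowerDoorToKitFO` for the all-known tracks; cell gate-hubbard-kl, seat hubbard-kl-k3c2-p3 g12 as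
#  SUBSTITUTE typer while the E1 lineage is unseated — E1 / the kit-dictionary lane (k3c3-p2) may rename or supersede)

The PRESCRIBED plateau doors (`Literature/…/SectorisedIncrementBoundGradedPrescribedPlateau`, `…GradedWeightedPrescribedPlateau`, `…Binomial(Weighted)PrescribedPlateau`;
at the block geometry `…EngineTowerBlockStep{Lev,WtFull}`, on the tower's increments `…EngineTowerBlockIncrWtFull`) bound a born increment of degree `m + 1 = 2p` whose
other legs are prescribed by `cr·cc^m·[Σ_{n∈Ico 2 N₀} κ^{-(m+1)} κ^{-2(n−1)} α^{n−1} eⁿ · Σ_δ Σ_{pf : J → Fin n} (Π_j 2δ_{pf j})/(Σ_a 2δ_a)^{|J|} · Π_a (e³κ)^{2δ_a}·(ρc^{c_a}·ε·B(δ_a, c_a))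
+ ρ^{-(m+1)}·tail(normV κ ρ (ε·B(·,0)))]` (`c_a = #pf⁻¹(a)` prescribed legs landing on vertex `a`) and, at first order, by the binomial-prescribed sum.  The kit's induction
`towerBorn_le_law_tracks` (part 9′) wants, for EVERY track, `towerFO D σ μ p + Σ_{n∈Icc 2 N} e·Φ^{n−1}·ψ^p·towerS D τ μ n p + ψ^p·e·towerV D τ μ·(Φ·towerV)^N/(1−Φ·towerV)` with ONE
track-blind array `μ`.  This file is the dictionary for the prescribed shape, for ANY track-blind majorant `N` of the prescribed sizes (`ρc^c·ε·B(m′, c) ≤ N m′` for all `c`,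
`N 0 = 0`) and ANY kit parameters dominating the door's: `Φ := eα/κ²` (unchanged), `τ ≥ (e³κ)²` and `τ ≥ (e²(κ+ρ))²`, `ψ ≥ κ⁻²` and `ψ ≥ ρ⁻²`:

* §1 `sum_landingWeights_le_one` (the landing-profile weights average to `≤ 1`: `Fintype.prod_sum`), `towerV_mono`, `normV_mono`, and the falling-factorial row
  `inv_factorial_mul_pow_le_choose` (`((2p)!)⁻¹·(2m′)^{2p} ≤ (e²)^{p+1}/2 · C(2m′, 2p)` for `p + 1 ≤ m′`, from `x^n/n! ≤ eˣ`);
* §2 **`doorGradedPrescribed_le_kitStep`** — the graded-prescribed bracket + tail `≤ Σ_{n∈Icc 2 (N₀−1)} e·Φ^{n−1}·ψ^p·towerS D τ N n p + ψ^p·[kit tail in towerV D τ N]` under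
  the kit's guard `Φ·towerV D τ N < 1`;
* §3 **`doorBinomialPrescribed_le_towerFO`** — the pin-free binomial-prescribed sum `Σ_{m′} 𝟙[p < m′]·((2p)!)⁻¹(2m′)^{2p}κ^{2m′−2p}·(ρc^{2p−1}·ε·B m′ (2p−1))
  ≤ (e²)^{p+1}/2 · towerFO D κ² N p` (the prescribed door's `(2m′)^{|J|}` in place of falling factors costs `(e²)^{p+1}/2`, a per-degree constant that rides with `cc`).
Pure real analysis; nothing about the model is asserted; nothing asserts (ℓ), any stub, K3 or superconductivity.
References: BGM 2006 §2.8 (2.77), (2.81)–(2.84), §3 (3.2)–(3.8) [cite: BenfattoGiulianiMastropietro2006]; Gawȩdzki–Kupiainen 1985 §3.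
-/

noncomputable section

namespace Summit.HubbardSuperconductivity.HubbardSuperconductivity.Theorems.EngineV8

set_option linter.dupNamespace false -- summit = problem name (single-conjunct summit), D-0017

open Real Finset Literature.MathematicalPhysics.QuantumLattice
open scoped Nat

/-! ## §1 Elementary rows -/

/-- **The landing-profile weights average to at most one**: `Σ_{pf : J → Fin n} (Π_j u(pf j)) / (Σ_a u a)^{|J|} ≤ 1` for `u ≥ 0`
(`Π_j Σ_a = Σ_{pf} Π_j`, then `x/x ≤ 1`). -/
theorem sum_landingWeights_le_one {Jt : Type*} [Fintype Jt] [DecidableEq Jt] {n : ℕ} (u : Fin n → ℝ) :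
    ∑ pf : Jt → Fin n, (∏ j, u (pf j)) / (∑ a, u a) ^ Fintype.card Jt ≤ 1 := by
  rw [← Finset.sum_div, ← Fintype.prod_sum (fun (_ : Jt) (a : Fin n) => u a), Finset.prod_const, Finset.card_univ]
  exact div_self_le_one _

/-- The landing weights of the doors, `u a := 2δ_a` cast to `ℝ` with the denominator cast as a natural-number sum, average to at most one. -/
theorem sum_landingWeights_cast_le_one {Jt : Type*} [Fintype Jt] [DecidableEq Jt] {n : ℕ} (δ : Fin n → ℕ) :
    ∑ pf : Jt → Fin n, (∏ j, ((2 * δ (pf j) : ℕ) : ℝ)) / ((∑ a, 2 * δ a : ℕ) : ℝ) ^ Fintype.card Jt ≤ 1 := by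
  have h := sum_landingWeights_le_one (Jt := Jt) (fun a : Fin n => ((2 * δ a : ℕ) : ℝ))
  rwa [← Nat.cast_sum] at h

/-- `towerV` is monotone in the field weight `τ ≥ 0` and in the sizes (pointwise, nonnegative). -/
theorem towerV_mono {D : ℕ} {τ τ' : ℝ} {μ μ' : ℕ → ℝ} (hτ : 0 ≤ τ) (hττ : τ ≤ τ') (hμ : ∀ m, 0 ≤ μ m) (hμμ : ∀ m, μ m ≤ μ' m) :
    towerV D τ μ ≤ towerV D τ' μ' := by
  unfold towerV
  refine sum_le_sum fun m _ => mul_le_mul (pow_le_pow_left₀ (by positivity) (mul_le_mul_of_nonneg_left hττ (exp_pos _).le) _)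
    (hμμ m) (hμ m) (by have := hτ.trans hττ; positivity)

/-- `towerS` is monotone in `τ ≥ 0` and in the sizes (pointwise, nonnegative). -/
theorem towerS_mono {D n p : ℕ} {τ τ' : ℝ} {μ μ' : ℕ → ℝ} (hτ : 0 ≤ τ) (hττ : τ ≤ τ') (hμ : ∀ m, 0 ≤ μ m) (hμμ : ∀ m, μ m ≤ μ' m) :
    towerS D τ μ n p ≤ towerS D τ' μ' n p := by
  unfold towerS
  refine sum_le_sum fun δ _ => prod_le_prod (fun a _ => mul_nonneg (pow_nonneg hτ _) (hμ _)) fun a _ => ?_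
  exact mul_le_mul (pow_le_pow_left₀ hτ hττ _) (hμμ _) (hμ _) (pow_nonneg (hτ.trans hττ) _)

/-- `normV` is monotone in the sizes (pointwise), `κ, ρ ≥ 0`. -/
theorem normV_mono {Γ : Type*} [Fintype Γ] {κ ρ : ℝ} (hκ : 0 ≤ κ) (hρ : 0 ≤ ρ) {N N' : ℕ → ℝ} (hNN : ∀ m, N m ≤ N' m) :
    normV Γ κ ρ N ≤ normV Γ κ ρ N' := by
  unfold normV
  exact sum_le_sum fun m _ => mul_le_mul_of_nonneg_left (hNN m) (by positivity)

/-- **Falling factorial versus power**: for `p + 1 ≤ m′`, `((2p)!)⁻¹·(2m′)^{2p} ≤ (e²)^{p+1}/2 · C(2m′, 2p)`.  (Each factor `2m′/(2m′−i) ≤ (2p+2)/(2p+2−i)`, and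
`2·(2p+2)^{2p}/(2p+2)! ≤ e^{2p+2}/2` from `xⁿ/n! ≤ eˣ` at `x = n = 2p+2`.) -/
theorem inv_factorial_mul_pow_le_choose {p m' : ℕ} (hm : p + 1 ≤ m') :
    ((((2 * p) !) : ℝ))⁻¹ * ((2 * m' : ℕ) : ℝ) ^ (2 * p) ≤ (exp 2) ^ (p + 1) / 2 * ((2 * m').choose (2 * p) : ℝ) := by
  set P : ℝ := ((2 * p + 2 : ℕ) : ℝ) with hP
  set A : ℝ := ((2 * m' : ℕ) : ℝ) with hA
  set d : ℝ := (((2 * p + 2).descFactorial (2 * p) : ℕ) : ℝ) with hd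
  set Dm : ℝ := (((2 * m').descFactorial (2 * p) : ℕ) : ℝ) with hDm
  have hPA : P ≤ A := by rw [hP, hA]; exact_mod_cast (by omega : 2 * p + 2 ≤ 2 * m')
  have hP0 : 0 < P := by rw [hP]; positivity
  have hP2 : P = 2 * p + 2 := by rw [hP]; push_cast; ring
  -- the two falling factorials as products
  have hDm_eq : Dm = ∏ i ∈ range (2 * p), (A - i) := by
    rw [hDm, hA, Nat.descFactorial_eq_prod_range, Nat.cast_prod]
    refine prod_congr rfl fun i hi => ?_
    rw [Nat.cast_sub (by have := mem_range.1 hi; omega)]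
  have hd_eq : d = ∏ i ∈ range (2 * p), (P - i) := by
    rw [hd, hP, Nat.descFactorial_eq_prod_range, Nat.cast_prod]
    refine prod_congr rfl fun i hi => ?_
    rw [Nat.cast_sub (by have := mem_range.1 hi; omega)]
  have hd0 : 0 < d := by
    rw [hd]; exact_mod_cast Nat.pos_of_ne_zero ((Nat.descFactorial_pos.2 (by omega)).ne')
  have hdf : d * 2 = (((2 * p + 2) !) : ℝ) := by
    have h := Nat.factorial_mul_descFactorial (show 2 * p ≤ 2 * p + 2 by omega)
    rw [show 2 * p + 2 - 2 * p = 2 by omega] at h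
    rw [hd, mul_comm]
    have h2 : ((2 : ℕ) ! : ℝ) = 2 := by norm_num [Nat.factorial]
    rw [← h2]; exact_mod_cast h
  -- (1) factorwise `A·(P−i)/P ≤ A − i`, hence `A^{2p}·(d/P^{2p}) ≤ Dm`
  have hfac : ∀ i ∈ range (2 * p), A * ((P - i) / P) ≤ A - i := by
    intro i hi
    have hi' : (i : ℝ) ≤ 2 * p := by exact_mod_cast (mem_range.1 hi).le
    rw [mul_div_assoc', div_le_iff₀ hP0]
    rw [hP2] at hPA ⊢
    nlinarith [hPA, hi', (Nat.cast_nonneg i : (0 : ℝ) ≤ i)]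
  have hfac0 : ∀ i ∈ range (2 * p), 0 ≤ A * ((P - i) / P) := by
    intro i hi
    have hi' : (i : ℝ) ≤ 2 * p := by exact_mod_cast (mem_range.1 hi).le
    have : 0 ≤ P - i := by rw [hP2]; linarith
    have hA0 : 0 ≤ A := by rw [hA]; positivity
    positivity
  have hprod : A ^ (2 * p) * (d / P ^ (2 * p)) ≤ Dm := by
    have h := prod_le_prod hfac0 hfac
    rw [prod_mul_distrib, prod_const, card_range, prod_div_distrib, prod_const, card_range, ← hd_eq, ← hDm_eq] at h
    exact h
  have h1 : A ^ (2 * p) ≤ Dm * (P ^ (2 * p) / d) := by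
    have hPp : 0 < P ^ (2 * p) := by positivity
    calc A ^ (2 * p) = A ^ (2 * p) * (d / P ^ (2 * p)) * (P ^ (2 * p) / d) := by field_simp
      _ ≤ Dm * (P ^ (2 * p) / d) := mul_le_mul_of_nonneg_right hprod (by positivity)
  -- (2) `P^{2p}/d ≤ e^{2p+2}/2` from `Pⁿ/n! ≤ e^P` (`n = 2p+2`) and `P² ≥ 4`
  have hexp : P ^ (2 * p + 2) ≤ exp 2 ^ (p + 1) * (((2 * p + 2) !) : ℝ) := by
    have h := Real.pow_div_factorial_le_exp (x := P) hP0.le (2 * p + 2)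
    rw [div_le_iff₀ (by positivity)] at h
    have he : exp P = exp 2 ^ (p + 1) := by
      rw [← Real.exp_nat_mul, hP2]; congr 1; push_cast; ring
    rwa [he] at h
  have h2 : P ^ (2 * p) / d ≤ exp 2 ^ (p + 1) / 2 := by
    rw [div_le_div_iff₀ hd0 (by norm_num : (0 : ℝ) < 2)]
    have h4 : (4 : ℝ) ≤ P ^ 2 := by rw [hP2]; nlinarith
    have hx : 0 ≤ P ^ (2 * p) := by positivity
    have hsq : P ^ (2 * p + 2) = P ^ (2 * p) * P ^ 2 := by rw [← pow_add]
    have h5 : P ^ (2 * p) * 4 ≤ exp 2 ^ (p + 1) * (d * 2) := by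
      calc P ^ (2 * p) * 4 ≤ P ^ (2 * p) * P ^ 2 := mul_le_mul_of_nonneg_left h4 hx
        _ = P ^ (2 * p + 2) := hsq.symm
        _ ≤ exp 2 ^ (p + 1) * (((2 * p + 2) !) : ℝ) := hexp
        _ = exp 2 ^ (p + 1) * (d * 2) := by rw [hdf]
    nlinarith [h5]
  -- (3) assemble with `C(2m′,2p) = Dm/(2p)!`
  have hchoose : ((2 * m').choose (2 * p) : ℝ) = Dm / (((2 * p) !) : ℝ) := by
    rw [eq_div_iff (by positivity), mul_comm, hDm]
    exact_mod_cast (Nat.descFactorial_eq_factorial_mul_choose (2 * m') (2 * p)).symm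
  rw [hchoose]
  have hDm0 : 0 ≤ Dm := by rw [hDm]; positivity
  calc ((((2 * p) !) : ℝ))⁻¹ * A ^ (2 * p)
      ≤ ((((2 * p) !) : ℝ))⁻¹ * (Dm * (exp 2 ^ (p + 1) / 2)) :=
        mul_le_mul_of_nonneg_left (h1.trans (mul_le_mul_of_nonneg_left h2 hDm0)) (by positivity)
    _ = exp 2 ^ (p + 1) / 2 * (Dm / (((2 * p) !) : ℝ)) := by
        field_simp

/-! ## §2 The graded-prescribed bracket is dominated by the kit's step right side -/

/-- **THE PRESCRIBED DOOR'S BRACKET IS DOMINATED BY THE KIT'S STEP RIGHT SIDE.**  Data: `κ, ρ > 0`, `α ≥ 0`, `ρc ≥ 0`, `ε ≥ 0`, prescribed sizes `B ≥ 0` with a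
track-blind majorant `N ≥ 0`, `N 0 = 0`, `ρc^c·(ε·B m′ c) ≤ N m′` for all `m′, c`; a degree bound `D ≥ |Γ|/2`; a truncation order `N₀ ≥ 2`; output degree `m + 1 = 2p`;
profiles indexed by any finite type `Jt`; kit parameters `τ ≥ (e³κ)²`, `τ ≥ (e²(κ+ρ))²`, `ψ ≥ κ⁻²`, `ψ ≥ ρ⁻²`, and the kit's guard `(eα/κ²)·towerV D τ N < 1`.  Then
`[prescribed graded sum over Ico 2 N₀] + [door tail in normV] ≤ Σ_{n∈Icc 2 (N₀−1)} e·Φ^{n−1}·ψ^p·towerS D τ N n p + ψ^p·[kit tail in towerV D τ N]`, `Φ = eα/κ²`. -/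
theorem doorGradedPrescribed_le_kitStep {Γ : Type*} [Fintype Γ] {Jt : Type*} [Fintype Jt] [DecidableEq Jt]
    {κ ρ α ρc ε : ℝ} (hκ : 0 < κ) (hρ : 0 < ρ) (hα : 0 ≤ α) (hρc : 0 ≤ ρc) (hε : 0 ≤ ε)
    {B : ℕ → ℕ → ℝ} (hB0 : ∀ m c, 0 ≤ B m c) {N : ℕ → ℝ} (hN0 : ∀ m, 0 ≤ N m) (hN00 : N 0 = 0)
    (hNB : ∀ m c, ρc ^ c * (ε * B m c) ≤ N m)
    {D : ℕ} (hD : Fintype.card Γ / 2 ≤ D) {N₀ : ℕ} (hN₀ : 2 ≤ N₀) {m p : ℕ} (hmp : m + 1 = 2 * p)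
    {τ ψ : ℝ} (hτ1 : (exp 3 * κ) ^ 2 ≤ τ) (hτ2 : (exp 2 * (κ + ρ)) ^ 2 ≤ τ) (hψ1 : κ⁻¹ ^ 2 ≤ ψ) (hψ2 : ρ⁻¹ ^ 2 ≤ ψ)
    (hguard : exp 1 * α / κ ^ 2 * towerV D τ N < 1) :
    (∑ n ∈ Ico 2 N₀, (κ⁻¹ ^ (m + 1) * κ⁻¹ ^ (2 * (n - 1)) * (α ^ (n - 1) * exp n)) *
        ∑ δ ∈ (Fintype.piFinset fun _ : Fin n => range (Fintype.card Γ / 2 + 1)) with m + 1 + 2 * (n - 1) ≤ ∑ a, 2 * δ a,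
          ∑ pf : Jt → Fin n, ((∏ j, ((2 * δ (pf j) : ℕ) : ℝ)) / ((∑ a, 2 * δ a : ℕ) : ℝ) ^ Fintype.card Jt) *
            ∏ a, (exp 3 * κ) ^ (2 * δ a) *
              (ρc ^ (univ.filter fun j : Jt => pf j = a).card * (ε * B (δ a) (univ.filter fun j : Jt => pf j = a).card))) +
      ρ⁻¹ ^ (m + 1) * (exp 1 * normV Γ κ ρ (fun m' => ρc ^ 0 * (ε * B m' 0))) *
        (exp 1 * α * normV Γ κ ρ (fun m' => ρc ^ 0 * (ε * B m' 0)) / κ ^ 2) ^ (N₀ - 1) /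
        (1 - exp 1 * α * normV Γ κ ρ (fun m' => ρc ^ 0 * (ε * B m' 0)) / κ ^ 2) ≤
    ∑ n ∈ Icc 2 (N₀ - 1), exp 1 * (exp 1 * α / κ ^ 2) ^ (n - 1) * ψ ^ p * towerS D τ N n p +
      ψ ^ p * (exp 1 * towerV D τ N * (exp 1 * α / κ ^ 2 * towerV D τ N) ^ (N₀ - 1) / (1 - exp 1 * α / κ ^ 2 * towerV D τ N)) := by
  set Φ := exp 1 * α / κ ^ 2 with hΦ
  have hΦ0 : 0 ≤ Φ := by rw [hΦ]; positivity
  have he3 : 0 ≤ exp 3 * κ := by positivity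
  have hτ0 : 0 ≤ (exp 3 * κ) ^ 2 := by positivity
  have hτ0' : 0 ≤ τ := hτ0.trans hτ1
  have hψ0 : 0 ≤ ψ := le_trans (by positivity) hψ1
  have hIco : Ico 2 N₀ = Icc 2 (N₀ - 1) := by
    ext n; simp only [mem_Ico, mem_Icc]; omega
  refine add_le_add ?_ ?_
  · -- graded part, order by order
    rw [hIco]
    refine sum_le_sum fun n hn => ?_
    have hn1 : 1 ≤ n := by have := (mem_Icc.1 hn).1; omega
    -- prefactor in kit form, then `κ⁻² ≤ ψ`
    have hcoef : κ⁻¹ ^ (m + 1) * κ⁻¹ ^ (2 * (n - 1)) * (α ^ (n - 1) * exp n) = exp 1 * Φ ^ (n - 1) * (κ⁻¹ ^ 2) ^ p := by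
      have h := door_coef_eq hκ.ne' (ρ := κ) α p (n - 1)
      rw [show n - 1 + 1 = n by omega] at h
      rw [hmp, hΦ]
      exact h
    rw [hcoef]
    have hc0 : 0 ≤ exp 1 * Φ ^ (n - 1) * (κ⁻¹ ^ 2) ^ p := by positivity
    have hcψ : exp 1 * Φ ^ (n - 1) * (κ⁻¹ ^ 2) ^ p ≤ exp 1 * Φ ^ (n - 1) * ψ ^ p :=
      mul_le_mul_of_nonneg_left (pow_le_pow_left₀ (by positivity) hψ1 p) (by positivity)
    -- inner sum: average the profiles away, enlarge the factor to `τ`, enlarge the range, then it IS `towerS`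
    have hinner : ∑ δ ∈ (Fintype.piFinset fun _ : Fin n => range (Fintype.card Γ / 2 + 1)) with m + 1 + 2 * (n - 1) ≤ ∑ a, 2 * δ a,
          ∑ pf : Jt → Fin n, ((∏ j, ((2 * δ (pf j) : ℕ) : ℝ)) / ((∑ a, 2 * δ a : ℕ) : ℝ) ^ Fintype.card Jt) *
            ∏ a, (exp 3 * κ) ^ (2 * δ a) *
              (ρc ^ (univ.filter fun j : Jt => pf j = a).card * (ε * B (δ a) (univ.filter fun j : Jt => pf j = a).card)) ≤
        towerS D τ N n p := by
      have hsub : ((Fintype.piFinset fun _ : Fin n => range (Fintype.card Γ / 2 + 1)).filter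
            fun δ : Fin n → ℕ => m + 1 + 2 * (n - 1) ≤ ∑ a, 2 * δ a) ⊆
          ((Fintype.piFinset fun _ : Fin n => range (D + 1)).filter fun δ : Fin n → ℕ => 2 * p + 2 * (n - 1) ≤ ∑ a, 2 * δ a) := by
        intro δ hδ
        rw [mem_filter, Fintype.mem_piFinset] at hδ ⊢
        exact ⟨fun a => mem_range.2 (lt_of_lt_of_le (mem_range.1 (hδ.1 a)) (by omega)), hmp ▸ hδ.2⟩
      -- per multi-degree `δ`: the profile average of a profile-wise bounded product
      have hδ : ∀ δ : Fin n → ℕ,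
          ∑ pf : Jt → Fin n, ((∏ j, ((2 * δ (pf j) : ℕ) : ℝ)) / ((∑ a, 2 * δ a : ℕ) : ℝ) ^ Fintype.card Jt) *
              ∏ a, (exp 3 * κ) ^ (2 * δ a) *
                (ρc ^ (univ.filter fun j : Jt => pf j = a).card * (ε * B (δ a) (univ.filter fun j : Jt => pf j = a).card)) ≤
            ∏ a, τ ^ (δ a) * N (δ a) := by
        intro δ
        have hY0 : 0 ≤ ∏ a, τ ^ (δ a) * N (δ a) := prod_nonneg fun a _ => mul_nonneg (pow_nonneg hτ0' _) (hN0 _)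
        have hterm : ∀ pf : Jt → Fin n,
            ((∏ j, ((2 * δ (pf j) : ℕ) : ℝ)) / ((∑ a, 2 * δ a : ℕ) : ℝ) ^ Fintype.card Jt) *
                ∏ a, (exp 3 * κ) ^ (2 * δ a) *
                  (ρc ^ (univ.filter fun j : Jt => pf j = a).card * (ε * B (δ a) (univ.filter fun j : Jt => pf j = a).card)) ≤
              ((∏ j, ((2 * δ (pf j) : ℕ) : ℝ)) / ((∑ a, 2 * δ a : ℕ) : ℝ) ^ Fintype.card Jt) * ∏ a, τ ^ (δ a) * N (δ a) := by
          intro pf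
          refine mul_le_mul_of_nonneg_left (prod_le_prod (fun a _ => ?_) fun a _ => ?_) (by positivity)
          · exact mul_nonneg (pow_nonneg he3 _) (mul_nonneg (pow_nonneg hρc _) (mul_nonneg hε (hB0 _ _)))
          · rw [pow_mul]
            exact mul_le_mul (pow_le_pow_left₀ hτ0 hτ1 _) (hNB _ _)
              (mul_nonneg (pow_nonneg hρc _) (mul_nonneg hε (hB0 _ _))) (pow_nonneg hτ0' _)
        calc _ ≤ ∑ pf : Jt → Fin n, ((∏ j, ((2 * δ (pf j) : ℕ) : ℝ)) / ((∑ a, 2 * δ a : ℕ) : ℝ) ^ Fintype.card Jt) *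
              ∏ a, τ ^ (δ a) * N (δ a) := sum_le_sum fun pf _ => hterm pf
          _ = (∑ pf : Jt → Fin n, (∏ j, ((2 * δ (pf j) : ℕ) : ℝ)) / ((∑ a, 2 * δ a : ℕ) : ℝ) ^ Fintype.card Jt) *
              ∏ a, τ ^ (δ a) * N (δ a) := by rw [sum_mul]
          _ ≤ 1 * ∏ a, τ ^ (δ a) * N (δ a) := mul_le_mul_of_nonneg_right (sum_landingWeights_cast_le_one δ) hY0
          _ = _ := one_mul _
      calc _ ≤ ∑ δ ∈ (Fintype.piFinset fun _ : Fin n => range (Fintype.card Γ / 2 + 1)) with m + 1 + 2 * (n - 1) ≤ ∑ a, 2 * δ a,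
            ∏ a, τ ^ (δ a) * N (δ a) := sum_le_sum fun δ _ => hδ δ
        _ ≤ ∑ δ ∈ (Fintype.piFinset fun _ : Fin n => range (D + 1)) with 2 * p + 2 * (n - 1) ≤ ∑ a, 2 * δ a,
            ∏ a, τ ^ (δ a) * N (δ a) :=
            sum_le_sum_of_subset_of_nonneg hsub fun δ _ _ => prod_nonneg fun a _ => mul_nonneg (pow_nonneg hτ0' _) (hN0 _)
        _ = towerS D τ N n p := sum_range_filter_prod_eq_towerS hn1 hN00 p
    have hS0 : 0 ≤ towerS D τ N n p := towerS_nonneg hτ0' hN0 n p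
    calc _ ≤ exp 1 * Φ ^ (n - 1) * (κ⁻¹ ^ 2) ^ p * towerS D τ N n p := mul_le_mul_of_nonneg_left hinner hc0
      _ ≤ exp 1 * Φ ^ (n - 1) * ψ ^ p * towerS D τ N n p := mul_le_mul_of_nonneg_right hcψ hS0
  · -- tail: sizes `ε·B(·,0) ≤ N`, `normV ≤ towerV D (e²(κ+ρ))² N ≤ towerV D τ N`, monotone tail, `ρ⁻² ≤ ψ`
    have hNN : ∀ m', ρc ^ 0 * (ε * B m' 0) ≤ N m' := fun m' => hNB m' 0
    have hN'0 : ∀ m', 0 ≤ ρc ^ 0 * (ε * B m' 0) := fun m' => mul_nonneg (pow_nonneg hρc _) (mul_nonneg hε (hB0 _ _))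
    have hV1 : normV Γ κ ρ (fun m' => ρc ^ 0 * (ε * B m' 0)) ≤ normV Γ κ ρ N := normV_mono hκ.le hρ.le hNN
    have hV2 : normV Γ κ ρ N ≤ towerV D ((exp 2 * (κ + ρ)) ^ 2) N := normV_le_towerV hκ.le hρ.le hN0 hN00 hD
    have hV3 : towerV D ((exp 2 * (κ + ρ)) ^ 2) N ≤ towerV D τ N := towerV_mono (by positivity) hτ2 hN0 fun _ => le_rfl
    have hV := hV1.trans (hV2.trans hV3)
    have hV0 : 0 ≤ normV Γ κ ρ (fun m' => ρc ^ 0 * (ε * B m' 0)) := normV_nonneg hκ.le hρ.le hN'0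
    have htail := geomTail_mono hΦ0 hV0 hV hguard (N₀ - 1)
    have hψp : ρ⁻¹ ^ (m + 1) ≤ ψ ^ p := by
      rw [hmp, pow_mul]; exact pow_le_pow_left₀ (by positivity) hψ2 p
    have hlhs : ρ⁻¹ ^ (m + 1) * (exp 1 * normV Γ κ ρ (fun m' => ρc ^ 0 * (ε * B m' 0))) *
          (exp 1 * α * normV Γ κ ρ (fun m' => ρc ^ 0 * (ε * B m' 0)) / κ ^ 2) ^ (N₀ - 1) /
          (1 - exp 1 * α * normV Γ κ ρ (fun m' => ρc ^ 0 * (ε * B m' 0)) / κ ^ 2) =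
        ρ⁻¹ ^ (m + 1) * (exp 1 * normV Γ κ ρ (fun m' => ρc ^ 0 * (ε * B m' 0)) *
          (Φ * normV Γ κ ρ (fun m' => ρc ^ 0 * (ε * B m' 0))) ^ (N₀ - 1) / (1 - Φ * normV Γ κ ρ (fun m' => ρc ^ 0 * (ε * B m' 0)))) := by
      rw [hΦ]
      have : exp 1 * α * normV Γ κ ρ (fun m' => ρc ^ 0 * (ε * B m' 0)) / κ ^ 2 =
          exp 1 * α / κ ^ 2 * normV Γ κ ρ (fun m' => ρc ^ 0 * (ε * B m' 0)) := by ring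
      rw [this]; ring
    rw [hlhs]
    have hTd0 : 0 ≤ exp 1 * normV Γ κ ρ (fun m' => ρc ^ 0 * (ε * B m' 0)) *
        (Φ * normV Γ κ ρ (fun m' => ρc ^ 0 * (ε * B m' 0))) ^ (N₀ - 1) / (1 - Φ * normV Γ κ ρ (fun m' => ρc ^ 0 * (ε * B m' 0))) :=
      div_nonneg (by positivity) (sub_nonneg.2 (((mul_le_mul_of_nonneg_left hV hΦ0).trans hguard.le)))
    exact mul_le_mul hψp htail hTd0 (pow_nonneg hψ0 _)

/-- **The prescribed door's tail sizes sit under the kit's `towerV`**: `normV Γ κ ρ (m′ ↦ ρc⁰·ε·B m′ 0) ≤ towerV D τ N` for a track-blind majorant `N`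
(`ρc^c·ε·B m′ c ≤ N m′`, `N 0 = 0`, `N ≥ 0`), `D ≥ |Γ|/2`, `τ ≥ (e²(κ+ρ))²`.  (So the kit's guard `Φ·towerV D τ N < 1` implies the door's `θ < 1`.) -/
theorem normV_prescribed_le_towerV {Γ : Type*} [Fintype Γ] {κ ρ ρc ε : ℝ} (hκ : 0 ≤ κ) (hρ : 0 ≤ ρ)
    {B : ℕ → ℕ → ℝ} {N : ℕ → ℝ} (hN0 : ∀ m, 0 ≤ N m) (hN00 : N 0 = 0)
    (hNB : ∀ m c, ρc ^ c * (ε * B m c) ≤ N m) {D : ℕ} (hD : Fintype.card Γ / 2 ≤ D) {τ : ℝ} (hτ2 : (exp 2 * (κ + ρ)) ^ 2 ≤ τ) :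
    normV Γ κ ρ (fun m' => ρc ^ 0 * (ε * B m' 0)) ≤ towerV D τ N :=
  (normV_mono hκ hρ fun m' => hNB m' 0).trans
    ((normV_le_towerV hκ hρ hN0 hN00 hD).trans (towerV_mono (by positivity) hτ2 hN0 fun _ => le_rfl))

/-! ## §3 The pin-free binomial-prescribed sum is dominated by `towerFO` up to `(e²)^{p+1}/2` -/

/-- **THE PIN-FREE BINOMIAL-PRESCRIBED SUM IS DOMINATED BY `towerFO`** (`σ := κ²`): for `κ ≥ 0`, `ρc, ε ≥ 0`, `B ≥ 0` with a track-blind majorant `N`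
(`ρc^c·ε·B m′ c ≤ N m′`), `D_Γ ≤ D`, output degree `2(q+1)`:
`Σ_{m′ < D_Γ+1} 𝟙[q+1 < m′]·((2(q+1))!)⁻¹·(2m′)^{2(q+1)}·κ^{2m′−2(q+1)}·(ρc^{2q+1}·ε·B m′ (2q+1)) ≤ (e²)^{q+2}/2 · towerFO D κ² N (q+1)`
(`inv_factorial_mul_pow_le_choose`: the prescribed door's powers `(2m′)^{2q+2}` in place of the falling factorial cost the per-degree constant `(e²)^{q+2}/2`). -/
theorem doorBinomialPrescribed_le_towerFO {κ ρc ε : ℝ} (hκ : 0 ≤ κ) (hρc : 0 ≤ ρc) (hε : 0 ≤ ε)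
    {B : ℕ → ℕ → ℝ} (hB0 : ∀ m c, 0 ≤ B m c) {N : ℕ → ℝ} (hNB : ∀ m c, ρc ^ c * (ε * B m c) ≤ N m)
    {DΓ D : ℕ} (hD : DΓ ≤ D) (q : ℕ) :
    ∑ m' ∈ range (DΓ + 1), (if q + 1 < m' then
        (((2 * (q + 1)) ! : ℝ))⁻¹ * ((2 * m' : ℕ) : ℝ) ^ (2 * (q + 1)) * κ ^ (2 * m' - 2 * (q + 1)) *
          (ρc ^ (2 * q + 1) * (ε * B m' (2 * q + 1))) else 0) ≤
      exp 2 ^ (q + 2) / 2 * towerFO D (κ ^ 2) N (q + 1) := by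
  rw [towerFO, ← sum_filter, mul_sum]
  have hsub : (range (DΓ + 1)).filter (fun m' => q + 1 < m') ⊆ Ioc (q + 1) D := by
    intro m' hm'
    rw [mem_filter, mem_range] at hm'
    rw [mem_Ioc]
    exact ⟨hm'.2, by omega⟩
  refine (sum_le_sum_of_subset_of_nonneg hsub fun m' _ _ => ?_).trans (sum_le_sum fun m' hm' => ?_)
  · exact mul_nonneg (mul_nonneg (mul_nonneg (by positivity) (by positivity)) (pow_nonneg hκ _))
      (mul_nonneg (pow_nonneg hρc _) (mul_nonneg hε (hB0 _ _)))
  · have hlt : q + 1 < m' := (mem_Ioc.1 hm').1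
    have hf := inv_factorial_mul_pow_le_choose (p := q + 1) (m' := m') (by omega)
    rw [show q + 1 + 1 = q + 2 by ring] at hf
    have hκp : κ ^ (2 * m' - 2 * (q + 1)) = (κ ^ 2) ^ (m' - (q + 1)) := by
      rw [← pow_mul, show 2 * (m' - (q + 1)) = 2 * m' - 2 * (q + 1) by omega]
    rw [hκp]
    have hσ : 0 ≤ (κ ^ 2) ^ (m' - (q + 1)) := by positivity
    calc (((2 * (q + 1)) ! : ℝ))⁻¹ * ((2 * m' : ℕ) : ℝ) ^ (2 * (q + 1)) * (κ ^ 2) ^ (m' - (q + 1)) * (ρc ^ (2 * q + 1) * (ε * B m' (2 * q + 1)))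
        ≤ exp 2 ^ (q + 2) / 2 * ((2 * m').choose (2 * (q + 1)) : ℝ) * (κ ^ 2) ^ (m' - (q + 1)) * N m' := by
          refine mul_le_mul (mul_le_mul_of_nonneg_right hf hσ) (hNB _ _) (mul_nonneg (pow_nonneg hρc _) (mul_nonneg hε (hB0 _ _)))
            (by positivity)
      _ = exp 2 ^ (q + 2) / 2 * (((2 * m').choose (2 * (q + 1)) : ℝ) * (κ ^ 2) ^ (m' - (q + 1)) * N m') := by ring


end Summit.HubbardSuperconductivity.HubbardSuperconductivity.Theorems.EngineV8

end
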